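import Literature.Probability.LatticeModels.ModifiedSimonInequality
import Literature.Probability.LatticeModels.SusceptibilityMeanFieldBound
import Literature.Probability.LatticeModels.BackboneKernel
import Literature.Probability.Percolation.NonBacktrackingPathCounting
import Literature.Probability.FitznerVanDerHofstad2017.NbwTwoStepRecursion
import HarnessLib

/-!
# Fisher's self-avoiding-walk bound for Ising correlations on `ℤ^d` and the lower bound `tanh β_c(d) > 1/(2d-1)`

Topic `Literature/Probability/LatticeModels`. Theorem-only file (no definition, no named fact, no sorry).
For the nearest-neighbour Ising model on `ℤ^d` (free boundary condition, zero field, `β ≥ 0`), with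
`σ(n; 0, x) = |sawWordsTo d n x|` the number of `n`-step self-avoiding walks `0 → x` (step-word encoding of
`Literature.Probability.Percolation`) and `σ(n) = |sawWords d n|`:

* `isingTwoPoint_free_le_sawSum` — **Fisher's inequality** (M. E. Fisher, *Critical temperatures of
  anisotropic Ising lattices. II. General upper bounds*, Phys. Rev. 162 (1967) 480–485: the pair correlation
  is bounded by the generating function of self-avoiding walks): `⟨σ₀σ_x⟩^∅_{Λ;β} ≤ ∑_{n ≤ |ℰ_Λ|} σ(n; 0, x) tanh(β)ⁿ`.
  PROOF (van der Waerden's high-temperature expansion, the tree's `isingTwoPoint_free_eq_hteSum_div`):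
  `⟨σ₀σ_x⟩ = g({0,x})/g(∅)`, `g(A) = ∑_{F ⊆ ℰ_Λ, ∂F = A} t^{|F|}`; an `F` with `∂F = {0, x}` connects `0` to `x`
  (handshake, `cconn_of_csources_eq`), so contains the edge set `W` of a self-avoiding walk `0 → x` (loop
  erasure, `exists_sawWordsTo_of_mem_openConn`); `∂W = {0, x}` (`oddVerts_wordEdges_of_isSAW`, with the tree's `oddVerts_union_of_disjoint`), so `F ↦ F ∖ W`
  maps injectively into `{∂ = ∅}` with `t^{|F|} = tⁿ t^{|F ∖ W|}`; sum over the walks.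
* `sum_isingTwoPoint_free_le_of_sawSum_le`, `sum_twoPointFree_le_of_sawSum_le`, `susceptibility_le_of_sawSum_le`,
  `lt_criticalBeta_of_sawSum_le` — **Fisher's criterion**: `∑_{n<N} σ(n) tanh(β)ⁿ ≤ K` for all `N` ⇒
  `∑_{x ∈ s} ⟨σ₀σ_x⟩ ≤ K` (finite volume, free state), `χ(β) ≤ K`, `β < β_c(d)` (`tanh β_c ≥ 1/μ(d)`).
* `lt_criticalBeta_of_tanh_le` — **`tanh β ≤ 1/(2d-1) ⇒ β < β_c(d)`** (`d ≥ 2`; memory-4 walk counting, the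
  tree's `sum_range_card_memFourWords_mul_pow_le`, Madras–Slade §1.2). For `d = 3`: `β_c(3) > artanh(1/5) = 0.2027…`.

References: M. E. Fisher, Phys. Rev. 162 (1967) 480 [Fisher1967]; N. Madras, G. Slade, *The Self-Avoiding Walk*
(1993), §1.2 [MadrasSlade1993]; H. Duminil-Copin, *Random currents expansion of the Ising model* (2016), §2.2.1.
-/

noncomputable section

open Finset Filter Topology
open scoped symmDiff ENNReal

namespace Literature.Probability.LatticeModels

open Literature.Probability.Percolation
open Literature.Probability.FitznerVanDerHofstad2017 (wordPos_wordInit)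

variable {d : ℕ}

section Parity

variable {V : Type*} [DecidableEq V]

/-- `∂(F ∖ W) = ∂F ∆ ∂W` for `W ⊆ F`. [folklore] -/
private theorem oddVerts_sdiff (Λ : Finset V) {F W : Finset (Sym2 V)} (h : W ⊆ F) :
    oddVerts Λ (F \ W) = oddVerts Λ F ∆ oddVerts Λ W := by
  have hF : F = F \ W ∪ W := (sdiff_union_of_subset h).symm
  conv_rhs => rw [hF, oddVerts_union_of_disjoint Λ sdiff_disjoint]
  rw [symmDiff_assoc, symmDiff_self, symmDiff_bot]

end Parity

section Words

/-- The prefix of a self-avoiding word is self-avoiding. [folklore] -/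
private theorem isSAW_wordInit {n : ℕ} {w : Fin (n + 1) → Fin d × Bool} (h : IsSAW w) : IsSAW (wordInit w) := by
  intro i j hi hj hij
  rw [wordPos_wordInit w hi, wordPos_wordInit w hj] at hij
  exact h i j (by omega) (by omega) hij

/-- The edges of a word of length `n + 1` are those of its prefix plus the last step. [folklore] -/
private theorem wordEdges_succ {n : ℕ} (w : Fin (n + 1) → Fin d × Bool) :
    wordEdges w = insert s(wordPos w n, wordPos w (n + 1)) (wordEdges (wordInit w)) := by
  ext e
  simp only [wordEdges, mem_image, mem_range, mem_insert]
  constructor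
  · rintro ⟨k, hk, rfl⟩
    rcases Nat.lt_succ_iff_lt_or_eq.1 hk with hk | rfl
    · exact Or.inr ⟨k, hk, by rw [wordPos_wordInit w hk.le, wordPos_wordInit w hk]⟩
    · exact Or.inl rfl
  · rintro (rfl | ⟨k, hk, rfl⟩)
    · exact ⟨n, Nat.lt_succ_self n, rfl⟩
    · exact ⟨k, by omega, by rw [wordPos_wordInit w hk.le, wordPos_wordInit w hk]⟩

/-- **The edge set of a self-avoiding walk `0 → x` has odd vertices exactly `{0} ∆ {x}`** (interior sites
have degree `2`, the endpoints degree `1`; for the empty walk both sides are `∅`). [folklore] -/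
private theorem oddVerts_wordEdges_of_isSAW {Λ : Finset (Site d)} :
    ∀ {n : ℕ} {w : Fin n → Fin d × Bool}, IsSAW w → (∀ k ≤ n, wordPos w k ∈ Λ) →
      oddVerts Λ (wordEdges w) = {0} ∆ {wordPos w n}
  | 0, w, _, _ => by
      have h0 : wordEdges w = ∅ := by simp [wordEdges]
      rw [h0, oddVerts_empty, wordPos_zero, symmDiff_self]
      rfl
  | n + 1, w, hw, hΛ => by
      have hinit := oddVerts_wordEdges_of_isSAW (isSAW_wordInit hw)
        (fun k hk => by rw [wordPos_wordInit w hk]; exact hΛ k (by omega))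
      rw [wordPos_wordInit w le_rfl] at hinit
      have hne : wordPos w n ≠ wordPos w (n + 1) := fun h => by
        have := hw n (n + 1) (by omega) le_rfl h; omega
      have hnot : s(wordPos w n, wordPos w (n + 1)) ∉ wordEdges (wordInit w) := by
        intro hmem
        rw [wordEdges, Finset.mem_image] at hmem
        obtain ⟨k, hk, hke⟩ := hmem
        rw [Finset.mem_range] at hk
        rw [wordPos_wordInit w hk.le, wordPos_wordInit w hk, Sym2.eq_iff] at hke
        rcases hke with ⟨h1, -⟩ | ⟨h1, h2⟩
        · have := hw k n (by omega) (by omega) h1; omega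
        · have := hw k (n + 1) (by omega) le_rfl h1; omega
      rw [wordEdges_succ, oddVerts_insert (hΛ n (by omega)) (hΛ (n + 1) le_rfl) hnot, hinit, pair_eq_symmDiff hne,
        symmDiff_comm ({wordPos w (n + 1)} : Finset (Site d)) {wordPos w n}, ← symmDiff_assoc, symmDiff_symmDiff_cancel_right]

end Words

section Fisher

/-- **An edge set with odd vertices `{0, x}` contains a self-avoiding walk `0 → x`.** For
`F ⊆ ℰ_Λ` with `∂F = {0} ∆ {x}`, `x ≠ 0`, some self-avoiding word `w` of length `n ≤ |F|` ending at
`x` has all its edges in `F` (handshake + loop erasure). [folklore] -/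
private theorem exists_sawWordsTo_of_oddVerts_eq {Λ : Finset (Site d)} {F : Finset (Sym2 (Site d))}
    (hF : F ⊆ edgesIn (zdGraph d) Λ) {x : Site d} (hx : x ≠ 0) (hodd : oddVerts Λ F = {0} ∆ {x}) :
    ∃ n, n ≤ F.card ∧ ∃ w ∈ sawWordsTo d n x, wordEdges w ⊆ F := by
  classical
  -- the current `1_F`
  set m : edgesIn (zdGraph d) Λ → ℕ := fun e => if (e : Sym2 (Site d)) ∈ F then 1 else 0 with hm
  have hoddE : oddEdges (zdGraph d) Λ m = F := by
    ext e
    rw [oddEdges, Finset.mem_map]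
    constructor
    · rintro ⟨e', he', rfl⟩
      have hodd : Odd (m e') := (mem_filter.1 he').2
      by_contra hnot
      have hnot' : (e' : Sym2 (Site d)) ∉ F := hnot
      have hzero : m e' = 0 := by rw [hm]; exact if_neg hnot'
      rw [hzero] at hodd
      exact (Nat.not_odd_iff_even.2 (by decide)) hodd
    · intro he
      refine ⟨⟨e, hF he⟩, mem_filter.2 ⟨mem_univ _, ?_⟩, rfl⟩
      have hone : m ⟨e, hF he⟩ = 1 := by rw [hm]; exact if_pos he
      rw [hone]; exact odd_one
  have hsrc : csources (zdGraph d) Λ m = {0} ∆ {x} := by rw [csources_eq_oddVerts, hoddE, hodd]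
  have hconn := cconn_of_csources_eq (G := zdGraph d) (Λ := Λ) hx.symm hsrc
  -- connection through `F` is reachability in the open graph of `F`
  have hreach : (openGraph (↑F : Set (Sym2 (Site d)))).Reachable 0 x := by
    rw [SimpleGraph.reachable_iff_reflTransGen]
    have hstep : ∀ a b : Site d, (∃ e : edgesIn (zdGraph d) Λ, (e : Sym2 (Site d)) ∈ edgesIn (zdGraph d) Λ ∧ 0 < m e ∧
        (e : Sym2 (Site d)) = s(a, b)) → (openGraph (↑F : Set (Sym2 (Site d)))).Adj a b := by
      rintro a b ⟨e, -, hpos, hes⟩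
      have heF : (e : Sym2 (Site d)) ∈ F := by
        by_contra hnot
        have hzero : m e = 0 := by rw [hm]; exact if_neg hnot
        omega
      rw [openGraph_adj]
      refine ⟨by rw [← hes]; exact heF, ?_⟩
      have hadj : (zdGraph d).Adj a b := by
        have := (mem_edgesIn_iff.1 e.2).1
        rw [hes] at this
        exact (SimpleGraph.mem_edgeSet _).1 this
      exact hadj.ne
    unfold CConn at hconn
    clear hsrc hodd hx hoddE
    clear_value m
    induction hconn with
    | refl => exact Relation.ReflTransGen.refl
    | tail _ hbc ih => exact ih.tail (hstep _ _ hbc)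
  have hsub : (↑F : Set (Sym2 (Site d))) ⊆ (zdGraph d).edgeSet := fun e he => (mem_edgesIn_iff.1 (hF he)).1
  obtain ⟨n, w, hw, hwF⟩ := exists_sawWordsTo_of_mem_openConn x hsub hreach
  have hwF' : wordEdges w ⊆ F := fun e he => hwF (Finset.mem_coe.2 he)
  refine ⟨n, ?_, w, hw, hwF'⟩
  have hsaw : IsSAW w := mem_sawWords.1 (mem_filter.1 hw).1
  rw [← hsaw.card_wordEdges]
  exact card_le_card hwF'

/-- **Fisher's inequality for the high-temperature sums**: for `t ≥ 0`, `x ≠ 0`,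
`g_Λ({0} ∆ {x}) ≤ (∑_{n ≤ |ℰ_Λ|} σ(n; 0, x) tⁿ) · g_Λ(∅)`.
[cite: Fisher1967, Phys. Rev. 162 (1967) 480, the correlation bound by self-avoiding-walk generating functions] -/
theorem hteSum_pair_le_sawSum_mul (Λ : Finset (Site d)) {t : ℝ} (ht : 0 ≤ t) {x : Site d} (hx : x ≠ 0) :
    hteSum (zdGraph d) Λ t ({0} ∆ {x}) ≤
      (∑ n ∈ range (#(edgesIn (zdGraph d) Λ) + 1), ((sawWordsTo d n x).card : ℝ) * t ^ n) * hteSum (zdGraph d) Λ t ∅ := by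
  classical
  set E := edgesIn (zdGraph d) Λ with hE
  set N := #E + 1 with hN
  set P : Finset (Finset (Sym2 (Site d))) := E.powerset.filter (fun F => oddVerts Λ F = {0} ∆ {x}) with hP
  set P0 : Finset (Finset (Sym2 (Site d))) := E.powerset.filter (fun F => oddVerts Λ F = ∅) with hP0
  have hg : hteSum (zdGraph d) Λ t ({0} ∆ {x}) = ∑ F ∈ P, t ^ #F := rfl
  have hg0 : hteSum (zdGraph d) Λ t ∅ = ∑ F ∈ P0, t ^ #F := rfl
  -- Step 1: union bound over the self-avoiding walks contained in `F`
  have step1 : ∑ F ∈ P, t ^ #F ≤ ∑ F ∈ P, ∑ n ∈ range N, ∑ w ∈ sawWordsTo d n x, if wordEdges w ⊆ F then t ^ #F else 0 := by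
    refine sum_le_sum fun F hF => ?_
    obtain ⟨hFE, hodd⟩ := mem_filter.1 hF
    rw [mem_powerset] at hFE
    obtain ⟨n, hn, w, hw, hwF⟩ := exists_sawWordsTo_of_oddVerts_eq hFE hx hodd
    have hnN : n ∈ range N := mem_range.2 (by have := card_le_card hFE; omega)
    have h1 : t ^ #F ≤ ∑ w' ∈ sawWordsTo d n x, if wordEdges w' ⊆ F then t ^ #F else 0 := by
      refine le_trans (le_of_eq (by rw [if_pos hwF])) (single_le_sum (f := fun w' => if wordEdges w' ⊆ F then t ^ #F else 0)
        (fun w' _ => by split_ifs <;> positivity) hw)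
    exact h1.trans (single_le_sum (f := fun n' => ∑ w' ∈ sawWordsTo d n' x, if wordEdges w' ⊆ F then t ^ #F else 0)
      (fun n' _ => sum_nonneg fun w' _ => by split_ifs <;> positivity) hnN)
  -- Step 2: for a fixed walk, `F ↦ F ∖ W` is an injection into `{∂ = ∅}`
  have step2 : ∀ n ∈ range N, ∀ w ∈ sawWordsTo d n x,
      ∑ F ∈ P, (if wordEdges w ⊆ F then t ^ #F else 0) ≤ t ^ n * ∑ F ∈ P0, t ^ #F := by
    intro n _ w hw
    have hsaw : IsSAW w := mem_sawWords.1 (mem_filter.1 hw).1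
    have hend : wordPos w n = x := (mem_filter.1 hw).2
    set W := wordEdges w with hW
    have hcardW : #W = n := hsaw.card_wordEdges
    rw [← sum_filter]
    set Q := P.filter (fun F => W ⊆ F) with hQ
    -- on `Q`, `t^{|F|} = tⁿ t^{|F ∖ W|}`
    have hsplit : ∑ F ∈ Q, t ^ #F = t ^ n * ∑ F ∈ Q, t ^ #(F \ W) := by
      rw [mul_sum]
      refine sum_congr rfl fun F hF => ?_
      have hWF : W ⊆ F := (mem_filter.1 hF).2
      rw [← pow_add, ← hcardW, add_comm, card_sdiff_add_card_eq_card hWF]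
    rw [hsplit]
    refine mul_le_mul_of_nonneg_left ?_ (pow_nonneg ht n)
    -- injectivity of `F ↦ F ∖ W` on `Q` and its image lies in `P0`
    have hinj : Set.InjOn (fun F => F \ W) (Q : Set (Finset (Sym2 (Site d)))) := by
      intro F hF F' hF' hFF'
      have hWF : W ⊆ F := (mem_filter.1 (Finset.mem_coe.1 hF)).2
      have hWF' : W ⊆ F' := (mem_filter.1 (Finset.mem_coe.1 hF')).2
      have : F \ W ∪ W = F' \ W ∪ W := by simp only at hFF'; rw [hFF']
      rwa [sdiff_union_of_subset hWF, sdiff_union_of_subset hWF'] at this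
    have himg : ∑ F' ∈ Q.image (fun F => F \ W), t ^ #F' = ∑ F ∈ Q, t ^ #(F \ W) :=
      sum_image fun F hF F' hF' h => hinj (Finset.mem_coe.2 hF) (Finset.mem_coe.2 hF') h
    rw [← himg]
    refine sum_le_sum_of_subset_of_nonneg (fun F' hF' => ?_) fun _ _ _ => pow_nonneg ht _
    obtain ⟨F, hF, rfl⟩ := mem_image.1 hF'
    obtain ⟨hFP, hWF⟩ := mem_filter.1 hF
    obtain ⟨hFE, hodd⟩ := mem_filter.1 hFP
    rw [mem_powerset] at hFE
    refine mem_filter.2 ⟨mem_powerset.2 (sdiff_subset.trans hFE), ?_⟩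
    have hpos : ∀ k ≤ n, wordPos w k ∈ Λ := by
      -- `n ≥ 1` since `x ≠ 0`; every visited site is an endpoint of an edge of `W ⊆ F ⊆ ℰ_Λ`
      have hn : n ≠ 0 := by
        rintro rfl
        exact hx (by rw [← hend, wordPos_zero])
      have key : ∀ j < n, wordPos w j ∈ Λ ∧ wordPos w (j + 1) ∈ Λ := by
        intro j hj
        have he : s(wordPos w j, wordPos w (j + 1)) ∈ W := mem_image.2 ⟨j, mem_range.2 hj, rfl⟩
        have := (mem_edgesIn_iff.1 (hFE (hWF he))).2
        exact ⟨this _ (Sym2.mem_mk_left _ _), this _ (Sym2.mem_mk_right _ _)⟩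
      intro k hk
      rcases Nat.lt_or_ge k n with hkn | hkn
      · exact (key k hkn).1
      · obtain ⟨j, hj⟩ : ∃ j, n = j + 1 := Nat.exists_eq_succ_of_ne_zero hn
        have hk' : k = j + 1 := by omega
        rw [hk']
        exact (key j (by omega)).2
    rw [oddVerts_sdiff Λ hWF, hodd, oddVerts_wordEdges_of_isSAW hsaw hpos, hend, symmDiff_self]
    rfl
  -- Step 3: assemble
  rw [hg, hg0]
  refine step1.trans ?_
  rw [sum_comm]
  calc ∑ n ∈ range N, ∑ F ∈ P, ∑ w ∈ sawWordsTo d n x, (if wordEdges w ⊆ F then t ^ #F else 0)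
      = ∑ n ∈ range N, ∑ w ∈ sawWordsTo d n x, ∑ F ∈ P, (if wordEdges w ⊆ F then t ^ #F else 0) := by
        refine sum_congr rfl fun n _ => ?_; rw [sum_comm]
    _ ≤ ∑ n ∈ range N, ∑ _w ∈ sawWordsTo d n x, t ^ n * ∑ F ∈ P0, t ^ #F :=
        sum_le_sum fun n hn => sum_le_sum fun w hw => step2 n hn w hw
    _ = (∑ n ∈ range N, ((sawWordsTo d n x).card : ℝ) * t ^ n) * ∑ F ∈ P0, t ^ #F := by
        rw [sum_mul]
        refine sum_congr rfl fun n _ => ?_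
        rw [sum_const, nsmul_eq_mul]; ring

/-- **Fisher's inequality** (free boundary condition, zero field, `β ≥ 0`): for a finite volume `Λ`
of `ℤ^d` containing `0` and `x`,  `⟨σ₀σ_x⟩^∅_{Λ;β} ≤ ∑_{n ≤ |ℰ_Λ|} σ(n; 0, x) tanh(β)ⁿ`, where
`σ(n; 0, x)` is the number of `n`-step self-avoiding walks from `0` to `x`.
[cite: Fisher1967, Phys. Rev. 162 (1967) 480, the correlation bound by self-avoiding-walk generating functions] -/
theorem isingTwoPoint_free_le_sawSum {β : ℝ} (hβ : 0 ≤ β) {Λ : Finset (Site d)} (h0 : (0 : Site d) ∈ Λ)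
    {x : Site d} (hx : x ∈ Λ) :
    isingTwoPoint (zdGraph d) Λ β 0 .free 0 x ≤
      ∑ n ∈ range (#(edgesIn (zdGraph d) Λ) + 1), ((sawWordsTo d n x).card : ℝ) * Real.tanh β ^ n := by
  classical
  have ht0 : 0 ≤ Real.tanh β := tanh_nonneg hβ
  by_cases hx0 : x = 0
  · subst hx0
    rw [isingTwoPoint_self]
    have h00 : (1 : ℝ) ≤ ((sawWordsTo d 0 (0 : Site d)).card : ℝ) * Real.tanh β ^ 0 := by
      rw [pow_zero, mul_one]
      have : (fun i : Fin 0 => i.elim0) ∈ sawWordsTo d 0 (0 : Site d) := by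
        rw [sawWordsTo, mem_filter, mem_sawWords]
        exact ⟨fun i j hi hj _ => by omega, wordPos_zero _⟩
      exact_mod_cast card_pos.2 ⟨_, this⟩
    exact h00.trans (single_le_sum (f := fun n => ((sawWordsTo d n (0 : Site d)).card : ℝ) * Real.tanh β ^ n)
      (fun n _ => by positivity) (mem_range.2 (Nat.succ_pos _)))
  rw [isingTwoPoint_free_eq_hteSum_div (zdGraph d) Λ β h0 hx]
  have hpos := hteSum_empty_pos (zdGraph d) Λ β
  rw [div_le_iff₀ hpos]
  exact hteSum_pair_le_sawSum_mul Λ ht0 hx0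

/-- **Summed Fisher bound**: if the self-avoiding-walk generating function is bounded, `∑_{n<N} σ(n) tanh(β)ⁿ ≤ K`
for all `N`, then `∑_{x ∈ s} ⟨σ₀σ_x⟩^∅_{Λ;β} ≤ K` for `0 ∈ Λ`, `s ⊆ Λ` (`β ≥ 0`).
[cite: Fisher1967, Phys. Rev. 162 (1967) 480 (T_c bounds from self-avoiding walks)] -/
theorem sum_isingTwoPoint_free_le_of_sawSum_le {β : ℝ} (hβ : 0 ≤ β) {K : ℝ}
    (hK : ∀ N : ℕ, ∑ n ∈ range N, ((sawWords d n).card : ℝ) * Real.tanh β ^ n ≤ K)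
    {Λ : Finset (Site d)} (h0 : (0 : Site d) ∈ Λ) {s : Finset (Site d)} (hs : s ⊆ Λ) :
    ∑ x ∈ s, isingTwoPoint (zdGraph d) Λ β 0 .free 0 x ≤ K := by
  classical
  have ht0 : 0 ≤ Real.tanh β := tanh_nonneg hβ
  set N := #(edgesIn (zdGraph d) Λ) + 1 with hN
  calc ∑ x ∈ s, isingTwoPoint (zdGraph d) Λ β 0 .free 0 x
      ≤ ∑ x ∈ s, ∑ n ∈ range N, ((sawWordsTo d n x).card : ℝ) * Real.tanh β ^ n :=
        sum_le_sum fun x hx => isingTwoPoint_free_le_sawSum hβ h0 (hs hx)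
    _ = ∑ n ∈ range N, (∑ x ∈ s, ((sawWordsTo d n x).card : ℝ)) * Real.tanh β ^ n := by
        rw [sum_comm]; refine sum_congr rfl fun n _ => ?_; rw [sum_mul]
    _ ≤ ∑ n ∈ range N, ((sawWords d n).card : ℝ) * Real.tanh β ^ n := by
        refine sum_le_sum fun n _ => mul_le_mul_of_nonneg_right ?_ (pow_nonneg ht0 n)
        exact_mod_cast sum_card_sawWordsTo_le (d := d) n s
    _ ≤ K := hK N

/-- The memory-4 majorant of the self-avoiding-walk generating function at the non-backtracking radius:
`∑_{n<N} σ(n) tⁿ ≤ ∑_{n<N} c_{n,4} tⁿ ≤ 1 + 24(2d-1)³` for `0 ≤ t ≤ 1/(2d-1)`, `d ≥ 2`. [cite: MadrasSlade1993, §1.2 ((1.2.11)–(1.2.14))] -/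
theorem sum_card_sawWords_mul_pow_le (hd : 2 ≤ d) {t : ℝ} (ht0 : 0 ≤ t) (ht : t ≤ 1 / (2 * d - 1)) (N : ℕ) :
    ∑ n ∈ range N, ((sawWords d n).card : ℝ) * t ^ n ≤ 1 + 24 * (2 * d - 1) ^ 3 := by
  refine le_trans (sum_le_sum fun n _ => mul_le_mul_of_nonneg_right ?_ (pow_nonneg ht0 n))
    (sum_range_card_memFourWords_mul_pow_le hd ht0 ht N)
  exact_mod_cast card_le_card (sawWords_subset_memFourWords d n)

/-- **The free two-point function is summable along finite sets** when the self-avoiding-walk generating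
function at `tanh β` is bounded by `K`: `∑_{x ∈ s} ⟨σ₀σ_x⟩^∅_β ≤ K` for every finite `s` (thermodynamic limit
of `sum_isingTwoPoint_free_le_of_sawSum_le` along boxes). [cite: Fisher1967, Phys. Rev. 162 (1967) 480 (T_c bounds from self-avoiding walks)] -/
theorem sum_twoPointFree_le_of_sawSum_le {β : ℝ} (hβ : 0 ≤ β) {K : ℝ}
    (hK : ∀ N : ℕ, ∑ n ∈ range N, ((sawWords d n).card : ℝ) * Real.tanh β ^ n ≤ K) (s : Finset (Site d)) :
    ∑ x ∈ s, twoPointFree d β x ≤ K := by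
  have hlim : hasBoxLimit_isingCorr_free d := hasBoxLimit_isingCorr_free_holds
  have htend : Tendsto (fun L : ℕ => ∑ x ∈ s, isingTwoPoint (zdGraph d) (box d L) β 0 .free 0 x) atTop
      (𝓝 (∑ x ∈ s, twoPointFree d β x)) :=
    tendsto_finsetSum s fun x _ => tendsto_isingTwoPoint_free hlim hβ x
  refine le_of_tendsto htend ?_
  filter_upwards [eventually_subset_box' s] with L hL
  exact sum_isingTwoPoint_free_le_of_sawSum_le hβ hK (zero_mem_box d L) hL

/-- **`χ(β) ≤ K`** when the self-avoiding-walk generating function at `tanh β` is bounded by `K` (`β ≥ 0`).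
[cite: Fisher1967, Phys. Rev. 162 (1967) 480 (T_c bounds from self-avoiding walks)] -/
theorem susceptibility_le_of_sawSum_le {β : ℝ} (hβ : 0 ≤ β) {K : ℝ}
    (hK : ∀ N : ℕ, ∑ n ∈ range N, ((sawWords d n).card : ℝ) * Real.tanh β ^ n ≤ K) :
    susceptibility d β ≤ ENNReal.ofReal K := by
  have hlim : hasBoxLimit_isingCorr_free d := hasBoxLimit_isingCorr_free_holds
  have hgks : ∀ {Λ A : Finset (Site d)} {β h : ℝ} {bc : BoundaryCondition (Site d)},
      gks_one (zdGraph d) (Λ := Λ) (A := A) (β := β) (h := h) (bc := bc) :=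
    Literature.Probability.LatticeModels.GKSInequalities.gks_one_holds (zdGraph d)
  have hG0 : ∀ y, 0 ≤ twoPointFree d β y := fun y => twoPointFree_nonneg hlim hgks hβ y
  rw [susceptibility_eq_iSup_box_sum]
  refine iSup_le fun L => ?_
  rw [← ENNReal.ofReal_sum_of_nonneg fun y _ => hG0 y]
  exact ENNReal.ofReal_le_ofReal (sum_twoPointFree_le_of_sawSum_le hβ hK (box d L))

/-- **Fisher's criterion `β < β_c(d)`**: if the self-avoiding-walk generating function at `tanh β` is
bounded (`∑_{n<N} σ(n) tanh(β)ⁿ ≤ K` for all `N`), then `χ(β) < ∞` and so `β < β_c(d)` (`d ≥ 2`, `β ≥ 0`;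
`χ = ∞` on `[β_c, ∞)` is the tree's `susceptibility_eq_top_of_criticalBeta_le`). This is `tanh β_c ≥ 1/μ(d)`.
[cite: Fisher1967, Phys. Rev. 162 (1967) 480 (T_c bounds from self-avoiding walks)] -/
theorem lt_criticalBeta_of_sawSum_le (hd : 2 ≤ d) {β : ℝ} (hβ : 0 ≤ β) {K : ℝ}
    (hK : ∀ N : ℕ, ∑ n ∈ range N, ((sawWords d n).card : ℝ) * Real.tanh β ^ n ≤ K) : β < criticalBeta d := by
  by_contra h
  have htop := susceptibility_eq_top_of_criticalBeta_le hd (not_lt.1 h)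
  have hle := susceptibility_le_of_sawSum_le hβ hK
  rw [htop] at hle
  exact ENNReal.top_ne_ofReal.symm (le_antisymm le_top hle) |>.elim

/-- **`χ(β) ≤ 1 + 24(2d-1)³ < ∞` for `tanh β ≤ 1/(2d-1)`** (`d ≥ 2`, `β ≥ 0`). [cite: MadrasSlade1993, §1.2] -/
theorem susceptibility_le_of_tanh_le (hd : 2 ≤ d) {β : ℝ} (hβ : 0 ≤ β) (ht : Real.tanh β ≤ 1 / (2 * d - 1)) :
    susceptibility d β ≤ ENNReal.ofReal (1 + 24 * (2 * d - 1) ^ 3) :=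
  susceptibility_le_of_sawSum_le hβ (sum_card_sawWords_mul_pow_le hd (tanh_nonneg hβ) ht)

/-- **`tanh β ≤ 1/(2d-1) ⇒ β < β_c(d)`** (`d ≥ 2`, `β ≥ 0`): Fisher's bound `tanh β_c(d) ≥ 1/μ(d)` with
`μ(d) < 2d - 1` (memory-4 walk counting). For `d = 3`: `β_c(3) > artanh(1/5) = 0.2027…`.
[cite: Fisher1967, Phys. Rev. 162 (1967) 480 (T_c bounds from self-avoiding walks)] [cite: MadrasSlade1993, §1.2] -/
theorem lt_criticalBeta_of_tanh_le (hd : 2 ≤ d) {β : ℝ} (hβ : 0 ≤ β) (ht : Real.tanh β ≤ 1 / (2 * d - 1)) :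
    β < criticalBeta d :=
  lt_criticalBeta_of_sawSum_le hd hβ (sum_card_sawWords_mul_pow_le hd (tanh_nonneg hβ) ht)

end Fisher

end Literature.Probability.LatticeModels

end
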